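import Literature.NumberTheory.LFunctions.HarmonicLinearMollifierOptimality
import HarnessLib

/-!
# The weighted (amplified) harmonic Cauchy–Schwarz functional on `S₂(q)*` and the length-budget
# ceiling statement for amplified one-piece mollifiers (cell landau-siegel, §B-fam, item U1)

Topic `Literature/NumberTheory/LFunctions` (namespace `Literature.NumberTheory.LFunctions.KMV2000`).
Sibling of `HarmonicLinearMollifierOptimality` (row famE-09: the NAMED statement
`KMV2000.LinearMollifierOptimality`, asserted by no one). Typed for the LANDAU–SIEGEL PROGRAMME
(cell `landau-siegel`, rung F-S3, sub-cell §B-fam), upgrade item **U1** of `B-fam/UPGRADE-BRIEF.md`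
v1.3 §U1 («S-fam-02′ LENGTH-BUDGET CEILING, decides (II-b)(iv) amplified C3′»): the RESULT-LEVEL
statement whose main-term MODEL is `KMV2000.AmplifiedLengthBudget` (`KMVAmplifiedDiagonalForms`).
FRAMING (cell rule): the programme SEARCHES and TYPES; nothing here is a claim about Landau–Siegel
zeros, and the ceiling statement below is NOT a theorem in print and is asserted by no one.

## What is typed

* `harmonicBetaW q W M := |Σʰ ω_f W(f) L(f,½) M(f)|² / (Σʰ ω_f W(f) · Σʰ ω_f W(f) |L(f,½)M(f)|²)` —
  the Cauchy–Schwarz functional of the tree (`CechMatomaki2025.beta`, [CechMatomaki2025, §2]) for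
  the family `S₂(q)*` (`KMV2000.famFinset`) with the RE-WEIGHTED harmonic measure `ω_f · W(f)`,
  `W ≥ 0` a real weight (the designs use `W = |A(f)|²`, `A` an amplifier); PROVED bookkeeping:
  `0 ≤ harmonicBetaW ≤ 1`, `harmonicBetaW ≤` the `ω·W`-proportion of `{L(f,½) ≠ 0}` (the mollifier
  principle of [KowalskiMichelVanderKam2000, p. 6] run with the weights `ω W`), and
  `harmonicBetaW q 1 M = harmonicBeta q M`.
* `amplifierWeight z Y f := |A_z(f)|²`, `A_z = KowalskiMichel2000.mollifier z Y`
  (`Σ_{1 ≤ n ≤ Y} z_n n^{−1/2} λ_f(n)`); PROVED: `amplifierWeight z 1 f = 1` on `S₂(q)*` when `z₁ = 1`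
  (`λ_f(1) = 1` for Hecke-normalised newforms).
* `WeightedMollifierCeiling : Prop` — **U1 at result level** (NOT IN PRINT, asserted by no one; a
  NAMED statement like `LinearMollifierOptimality`): for `0 < Δ < 1`, `0 < Δ₁ < 1`, every growth
  budget `C` and `ε₂ > 0`, eventually in the prime level `q`: for all real `x, z` with
  `x₁ = z₁ = 1`, `|x_m|, |z_n| ≤ C(ε) q^ε`, and all lengths `Y, M ≥ 1` with the SECOND-MOMENT budget
  `Y·M ≤ q̂^Δ` (the Dirichlet polynomial `A²M²` has length `(YM)² ≤ q̂^{2Δ}`, the in-range condition of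
  [KowalskiMichelVanderKam2000, Prop. 5.1]) AND the FIRST-MOMENT range `Y²·M ≤ q̂^{Δ₁}` (the
  polynomial `A²M` inside the range of [KowalskiMichelVanderKam2000, Prop. 4.1]; binder required by
  the cell's tables, `B-fam/UPGRADE-BRIEF.md` v1.3 «U1 HYPOTHESIS LIST»), the amplified functional
  obeys `harmonicBetaW q |A_z|² M_x ≤ Δ/(2(1+Δ)) + ε₂` (all-forms scale) — no amplified one-piece
  design beats the single-mollifier ceiling `KMV2000.envelope Δ` of the same budget.
* PROVED bookkeeping: `linearMollifierOptimality_of_weightedMollifierCeiling`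
  (`Y = 1`, `z = x`: the statement CONTAINS famE-09's `LinearMollifierOptimality`, so it is not in
  print a fortiori — nearest print as recorded there: [CechMatomaki2025, Thm 1.1 (ii), Remark 1.2]).

## References

* [KowalskiMichelVanderKam2000] p. 6 (mollifier principle), Props. 4.1/5.1 (ranges), Thm. 6.1 p. 20
  (the ceiling `Δ/(2(1+Δ))`), §8.4 p. 28. [held: paper:doi-10-1515-crll-2000-074]
* [CechMatomaki2025] §2 (the abstract functional), Thm 1.1 (ii) and Remark 1.2 p. 4.
  [held: paper:arxiv-2501.12526]
-/

noncomputable section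

open scoped Real
open CongruenceSubgroup Complex Finset
open Literature.NumberTheory.EllipticCurves.ModularForms

namespace Literature.NumberTheory.LFunctions.KMV2000

/-! ### The weighted harmonic Cauchy–Schwarz functional -/

/-- **The weighted harmonic Cauchy–Schwarz functional**
`β^h_{q,W}(M) = |Σʰ ω_f W(f) L(f,½)M(f)|² / (Σʰ ω_f W(f) · Σʰ ω_f W(f)|L(f,½)M(f)|²)`: the tree's
`CechMatomaki2025.beta` for `S₂(q)*` with the re-weighted measure `ω_f · W(f)` (`W = |A|²` for an
amplifier `A` in the cell's designs). [cite: KowalskiMichelVanderKam2000, p. 6 («`Σ^h_{Λ(f,½)≠0} 1 ≥ L(x)²/Q(x)`», here with weights `ω W`); CechMatomaki2025, §2 (derivation: re-weighted instance)] -/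
def harmonicBetaW (q : ℕ) [NeZero q] (W : CuspForm (Gamma0 q) 2 → ℝ)
    (M : CuspForm (Gamma0 q) 2 → ℂ) : ℝ :=
  CechMatomaki2025.beta (ι := ↥(famFinset q)) (fun f => IwaniecSarnak.harmonicWeight f.1 * W f.1)
    (fun f => IwaniecSarnak.centralValue f.1) (fun f => M f.1)

/-- `β^h_{q,W}(M) ≥ 0` for `W ≥ 0`. [cite: CechMatomaki2025, §2 (derivation: re-weighted instance)] -/
theorem harmonicBetaW_nonneg (q : ℕ) [NeZero q] {W : CuspForm (Gamma0 q) 2 → ℝ} (hW : ∀ f, 0 ≤ W f)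
    (M : CuspForm (Gamma0 q) 2 → ℂ) : 0 ≤ harmonicBetaW q W M :=
  CechMatomaki2025.beta_nonneg (ι := ↥(famFinset q))
    (w := fun f => IwaniecSarnak.harmonicWeight f.1 * W f.1)
    (L := fun f => IwaniecSarnak.centralValue f.1)
    (fun f => mul_nonneg (IwaniecSarnak.harmonicWeight_nonneg le_rfl f.1) (hW f.1)) (fun f => M f.1)

/-- `β^h_{q,W}(M) ≤ 1` for `W ≥ 0`. [cite: CechMatomaki2025, §2 (2.1) (derivation: re-weighted instance)] -/
theorem harmonicBetaW_le_one (q : ℕ) [NeZero q] {W : CuspForm (Gamma0 q) 2 → ℝ} (hW : ∀ f, 0 ≤ W f)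
    (M : CuspForm (Gamma0 q) 2 → ℂ) : harmonicBetaW q W M ≤ 1 :=
  CechMatomaki2025.beta_le_one (ι := ↥(famFinset q))
    (w := fun f => IwaniecSarnak.harmonicWeight f.1 * W f.1)
    (L := fun f => IwaniecSarnak.centralValue f.1)
    (fun f => mul_nonneg (IwaniecSarnak.harmonicWeight_nonneg le_rfl f.1) (hW f.1)) (fun f => M f.1)

open scoped Classical in
/-- **The mollifier principle with amplified weights**: for every `M` and every `W ≥ 0`, the
`ω W`-proportion of `{f ∈ S₂(q)* : L(f,½) ≠ 0}` is at least `β^h_{q,W}(M)` — the inequality the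
amplified designs of the cell feed into the pigeonhole (same measure `ω W` on both sides).
[cite: KowalskiMichelVanderKam2000, p. 6; CechMatomaki2025, (2.1) (derivation: re-weighted instance)] -/
theorem harmonicBetaW_le_proportion (q : ℕ) [NeZero q] {W : CuspForm (Gamma0 q) 2 → ℝ}
    (hW : ∀ f, 0 ≤ W f) (M : CuspForm (Gamma0 q) 2 → ℂ) :
    harmonicBetaW q W M ≤
      (∑ f ∈ (famFinset q).attach,
          if IwaniecSarnak.centralValue f.1 = 0 then 0
          else IwaniecSarnak.harmonicWeight f.1 * W f.1) /
        ∑ f ∈ (famFinset q).attach, IwaniecSarnak.harmonicWeight f.1 * W f.1 := by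
  have h := CechMatomaki2025.beta_le_nonvanishingProportion (ι := ↥(famFinset q))
    (w := fun f => IwaniecSarnak.harmonicWeight f.1 * W f.1)
    (L := fun f => IwaniecSarnak.centralValue f.1)
    (fun f => mul_nonneg (IwaniecSarnak.harmonicWeight_nonneg le_rfl f.1) (hW f.1)) (fun f => M f.1)
  simpa [harmonicBetaW, CechMatomaki2025.nonvanishingProportion, CechMatomaki2025.totalWeight,
    Finset.univ_eq_attach] using h

/-- The trivial weight recovers famE-09's functional: `β^h_{q,1}(M) = β^h_q(M)`.
[cite: KowalskiMichelVanderKam2000, p. 6 (derivation: `W = 1`)] -/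
theorem harmonicBetaW_one (q : ℕ) [NeZero q] (M : CuspForm (Gamma0 q) 2 → ℂ) :
    harmonicBetaW q (fun _ => 1) M = harmonicBeta q M := by
  simp only [harmonicBetaW, harmonicBeta, mul_one]

/-- Weights that agree on `S₂(q)*` give the same functional.
[cite: CechMatomaki2025, §2 (derivation: bookkeeping)] -/
theorem harmonicBetaW_congr (q : ℕ) [NeZero q] {W W' : CuspForm (Gamma0 q) 2 → ℝ}
    (h : ∀ f ∈ famFinset q, W f = W' f) (M : CuspForm (Gamma0 q) 2 → ℂ) :
    harmonicBetaW q W M = harmonicBetaW q W' M := by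
  unfold harmonicBetaW
  have hfun : (fun f : ↥(famFinset q) => IwaniecSarnak.harmonicWeight f.1 * W f.1) =
      fun f => IwaniecSarnak.harmonicWeight f.1 * W' f.1 := by
    funext f; rw [h f.1 f.2]
  rw [hfun]

/-! ### Amplifier weights -/

/-- **The amplifier weight** `|A_z(f)|²`, `A_z(f) = Σ_{1 ≤ n ≤ Y} z_n n^{−1/2} λ_f(n)`
(`KowalskiMichel2000.mollifier z Y`), the non-negative weight of the cell's amplified designs.
[cite: KowalskiMichelVanderKam2000, (9) p. 7 (derivation: the amplifier is a second Dirichlet-polynomial weight)] -/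
def amplifierWeight {q : ℕ} [NeZero q] (z : ℕ → ℝ) (Y : ℝ) (f : CuspForm (Gamma0 q) 2) : ℝ :=
  ‖KowalskiMichel2000.mollifier z Y f‖ ^ 2

/-- `|A_z(f)|² ≥ 0`. [cite: KowalskiMichelVanderKam2000, (9) p. 7 (derivation)] -/
theorem amplifierWeight_nonneg {q : ℕ} [NeZero q] (z : ℕ → ℝ) (Y : ℝ) (f : CuspForm (Gamma0 q) 2) :
    0 ≤ amplifierWeight z Y f :=
  sq_nonneg _

/-- **The trivial amplifier**: for `z₁ = 1` and length `Y = 1`, `A_z(f) = λ_f(1) = 1` on Hecke-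
normalised forms, so `|A_z(f)|² = 1` on `S₂(q)*`.
[cite: KowalskiMichelVanderKam2000, (9) p. 7 («`λ_f(1) = 1`») (derivation)] -/
theorem amplifierWeight_one {q : ℕ} [NeZero q] {z : ℕ → ℝ} (hz : z 1 = 1)
    {f : CuspForm (Gamma0 q) 2} (hf : f ∈ famFinset q) : amplifierWeight z 1 f = 1 := by
  have hnorm : IsNormalized f := (mem_famFinset.mp hf).2.2
  unfold amplifierWeight KowalskiMichel2000.mollifier
  rw [Nat.floor_one, Finset.Icc_self, Finset.sum_singleton, hz, Nat.cast_one, Complex.one_cpow,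
    GL2Family.heckeLambda_one_of_isNormalized hnorm]
  simp

/-! ### U1 at result level: the length-budget ceiling (NOT IN PRINT, asserted by no one) -/

/-- **U1 — the amplified length-budget ceiling (cell statement S-fam-02′ at result level; NOT IN
PRINT, asserted by no one; a NAMED statement with the same standing as
`KMV2000.LinearMollifierOptimality`, which it contains).** For every `0 < Δ < 1`, `0 < Δ₁ < 1`, every
growth budget `C` and every `ε₂ > 0`, eventually in the prime level `q`: for all real coefficient
sequences `x, z` with `x₁ = z₁ = 1` and `|x_m|, |z_n| ≤ C(ε) q^ε` (`CechMatomaki2025.CoeffBound`), and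
all lengths `Y, M ≥ 1` satisfying BOTH range binders — the SECOND-MOMENT budget `Y·M ≤ q̂^Δ`
(`(YM)² ≤ q̂^{2Δ}`: `A²M²` in the range of Prop. 5.1) and the FIRST-MOMENT range `Y²·M ≤ q̂^{Δ₁}`
(`A²M` in the range of Prop. 4.1) — the `|A_z|²`-weighted harmonic Cauchy–Schwarz functional of the
one-piece mollifier `M_x` of length `M` is at most the single-mollifier ceiling of the budget:
`β^h_{q,|A_z|²}(M_x) ≤ Δ/(2(1+Δ)) + ε₂` (all-forms scale; `Δ/(1+Δ)` of the even forms). Its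
main-term model is `KMV2000.AmplifiedLengthBudget` (`KMVAmplifiedDiagonalForms`); the cell's tables
(`B-fam/UPGRADE-BRIEF.md` v1.3) are numerically consistent with it inside both ranges and show the
first-moment binder cannot be dropped. Nearest print: as for `LinearMollifierOptimality`
([CechMatomaki2025, Thm 1.1 (ii)] for `GL(1)` one-piece mollifiers; «proofs of optimality of
mollifiers are very sparse», Remark 1.2; «the absolute limit of our method», [KowalskiMichelVanderKam2000,
§8.4 p. 28]). [cite: KowalskiMichelVanderKam2000, Thm. 6.1 p. 20 and §8.4 p. 28; CechMatomaki2025, Thm 1.1 (ii) and Remark 1.2 p. 4 (this amplified `GL(2)` statement is NOT in print; named statement, no instance asserted)] -/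
def WeightedMollifierCeiling : Prop :=
  ∀ Δ Δ₁ : ℝ, 0 < Δ → Δ < 1 → 0 < Δ₁ → Δ₁ < 1 → ∀ C : ℝ → ℝ, ∀ ε₂ : ℝ, 0 < ε₂ → ∃ q₀ : ℕ,
    ∀ (q : ℕ) [NeZero q], q.Prime → q₀ ≤ q → ∀ (x z : ℕ → ℝ) (Y M : ℝ), x 1 = 1 → z 1 = 1 →
      1 ≤ Y → 1 ≤ M → Y * M ≤ qhat q ^ Δ → Y ^ 2 * M ≤ qhat q ^ Δ₁ →
        CechMatomaki2025.CoeffBound C q (fun m => (x m : ℂ)) →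
        CechMatomaki2025.CoeffBound C q (fun n => (z n : ℂ)) →
          harmonicBetaW q (amplifierWeight z Y) (KowalskiMichel2000.mollifier x M) ≤
            Δ / (2 * (1 + Δ)) + ε₂

/-- `q̂ = √q/2π ≥ 1` once `q ≥ 64` (`π ≤ 4`). [cite: KowalskiMichelVanderKam2000, §2 p. 5 (`q̂ = √q/2π`) (derivation)] -/
theorem one_le_qhat {q : ℕ} (hq : 64 ≤ q) : 1 ≤ qhat q := by
  unfold qhat
  have hπ : (0 : ℝ) < 2 * π := by positivity
  rw [le_div_iff₀ hπ, one_mul]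
  have h64 : (64 : ℝ) ≤ q := by exact_mod_cast hq
  have h8 : (8 : ℝ) ≤ Real.sqrt q := by
    rw [show (8 : ℝ) = Real.sqrt 64 by rw [show (64 : ℝ) = 8 ^ 2 by norm_num, Real.sqrt_sq (by norm_num)]]
    exact Real.sqrt_le_sqrt h64
  linarith [Real.pi_le_four]

/-- **U1 contains famE-09**: the weighted ceiling with the trivial amplifier (`Y = 1`, `z = x`,
`|A_z|² = 1` on `S₂(q)*`) is exactly `LinearMollifierOptimality`. Hence `WeightedMollifierCeiling`
is not in print a fortiori. PROVED (bookkeeping).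
[cite: KowalskiMichelVanderKam2000, Thm. 6.1 p. 20 (derivation: `Y = 1` instance of the cell statement)] -/
theorem linearMollifierOptimality_of_weightedMollifierCeiling (h : WeightedMollifierCeiling) :
    LinearMollifierOptimality := by
  intro Δ hΔ hΔ1 C ε₂ hε
  obtain ⟨q₀, hq₀⟩ := h Δ Δ hΔ hΔ1 hΔ hΔ1 C ε₂ hε
  refine ⟨max q₀ 64, fun q _ hprime hq x hx1 hC => ?_⟩
  have hq₀q : q₀ ≤ q := le_trans (le_max_left _ _) hq
  have h64 : 64 ≤ q := le_trans (le_max_right _ _) hq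
  have hqhat : 1 ≤ qhat q := one_le_qhat h64
  have hM : 1 ≤ qhat q ^ Δ := Real.one_le_rpow hqhat hΔ.le
  have hbudget : (1 : ℝ) * qhat q ^ Δ ≤ qhat q ^ Δ := by rw [one_mul]
  have hfirst : (1 : ℝ) ^ 2 * qhat q ^ Δ ≤ qhat q ^ Δ := by rw [one_pow, one_mul]
  have hmain := hq₀ q hprime hq₀q x x 1 (qhat q ^ Δ) hx1 hx1 le_rfl hM hbudget hfirst hC hC
  have hW : harmonicBetaW q (amplifierWeight x 1) (KowalskiMichel2000.mollifier x (qhat q ^ Δ)) =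
      harmonicBeta q (KowalskiMichel2000.mollifier x (qhat q ^ Δ)) := by
    rw [harmonicBetaW_congr q (W' := fun _ => 1) (fun f hf => amplifierWeight_one hx1 hf),
      harmonicBetaW_one]
  rw [hW] at hmain
  exact hmain

end Literature.NumberTheory.LFunctions.KMV2000
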